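import Literature.NumberTheory.Sieve.SieveFrameworkFundamentalLemma
import HarnessLib

/-!
# The upper `β`-sieve, pointwise: `𝟙_{(n, P_v(z)) = 1} = ∑_{d ∣ (n, P_v(z))} λ_d + O(∑_r 2^{−Ar} τ(n)^{A+1} 𝟙_{(n, P_v(z_r)) = 1})`

Topic `Literature/NumberTheory/Sieve`, namespace `BetaSieve` (continuing
`SieveFrameworkFundamentalLemma.lean`: Rosser's truncation sets `BetaSieve.pred`, the weights
`χ = BetaSieve.ind`, the boundary indicator `χ̄ = BetaSieve.bdry`, the one-step identity
`BetaSieve.sum_moebius_ind_eq` and the level/boundary properties `BetaSieve.bdry_props`).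
Everything in this file is PROVED (theorems only).

We establish the POINTWISE form of the fundamental lemma for the upper `β`-sieve weights
`λ_d = μ(d) χ⁺(d)` (`χ⁺ = ind 1 β D`: keep a squarefree `d = p₁ ⋯ p_r`, `p₁ > ⋯ > p_r`, iff
`p₁ ⋯ p_m p_m^β < D` for all odd `m`), in the explicit one-sided shape

  `0 ≤ ∑_{d ∣ (n, P_v(z))} λ_d − 𝟙_{(n, P_v(z)) = 1}
     ≤ ∑_{1 ≤ r ≤ ω(n), log D < (r+β) log z} 2^{−Ar} τ(n)^{A+1} 𝟙_{(n, P_v(z^{θ^r})) = 1}`,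
  `θ = 1 − 1/β`,

for `β > 1`, `1 < z`, `1 < D`, `β log z ≤ log D` (i.e. `z ≤ D^{1/β}`), every `n ≥ 1`, `v`, `A`
(`P_v(z) = ∏_{p < z, p ∤ v} p`). This is Matomäki–Merikoski, arXiv:2112.11412, Lemma 3.2 (i)
("a technical version of the fundamental lemma of the sieve", with `z_r = z^{((β−1)/β)^r}` and the
range `r ≥ uθ − β` for `D = X^θ`, `z = X^{1/u}`: `log D < (r + β) log z ⟺ r > uθ − β`), whose
printed proof is exactly the argument formalised here: "`𝟙_{(n,P(z))=1} = ∑_{d ∣ (n,P(z))} λ_d −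
∑_{r odd} S_r(n)` … the sum in `S_r(n)` is non-empty only if `r ≥ uθ − β` … for every `r`, in the sum
defining `S_r(n)` one has `p_r ≥ z_r` … `S_r(n) ≤ ∑_{n = mk, p ∣ mk ⇒ p ≥ z_r} 2^{Aω(m) − Ar} ≤
2^{−Ar} τ(n)^{A+1} 𝟙_{(n, P(z_r)) = 1}`"; the case `v > 1` "write `n = n'v'` with `(n', v) = 1`".

* `BetaSieve.sum_moebius_ind_one_eq_sum_bdry` — for squarefree `T ≠ 1`:
  `∑_{d ∣ T} μ(d)χ⁺(d) = ∑_{d ∣ T/q(T)} χ̄⁺(d q(T))` (the boundary terms `S_r`, all `≥ 0`);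
* `BetaSieve.bdry_conditions` — a boundary term `t = d q(T)` has `θ^{ω(t)} log z ≤ log q(T)`
  ("`p_r ≥ z_r`") and `log D < (ω(t) + β) log z` ("`r ≥ uθ − β`") — the tree's `bdry_props`;
* `BetaSieve.sum_moebius_ind_one_le` — the count:
  `∑_{d ∣ T} μχ⁺ ≤ 𝟙_{T=1} + ∑_{1 ≤ r ≤ ω(T)} [log D < (r+β) log z ∧ θ^r log z ≤ log q(T)] τ(T)`;
* `BetaSieve.indicator_le_sum_weights`, `BetaSieve.sum_weights_le` — **Lemma 3.2 (i)** for
  `T = (n, P_v(z))` in the displayed form (`τ(T) ≤ 2^{−Ar} τ(n)^{A+1}` for `r ≤ ω(T)`, and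
  `q(T) ≥ z^{θ^r}` gives `(n, P_v(z^{θ^r})) = 1`).

## References

* K. Matomäki, J. Merikoski, *Siegel zeros, twin primes, Goldbach's conjecture, and primes in short
  intervals*, IMRN 2023 (arXiv:2112.11412), Lemma 3.2 (i) and its proof (§3.2).
  [cite: MatomakiMerikoski2023, Lemma 3.2 (i)]
* G. Greaves, *Sieves in Number Theory*, Springer (2001), §3.1.2 (2.12)–(2.15), §3.3.3 Lemmas 2–4
  (the inputs, formalised in `SieveFrameworkFundamentalLemma.lean`). [cite: Greaves2001, §3.3.3]
* J. Friedlander, H. Iwaniec, *Opera de Cribro*, AMS (2010), §6.5 (the source's "[Opera]").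
-/

open Finset
open scoped ArithmeticFunction.Moebius

noncomputable section

namespace Literature.NumberTheory.Sieve

namespace BetaSieve

variable {β D : ℝ}

/-! ### The boundary expansion of the upper sieve -/

/-- For the UPPER sieve (`par = 1`) the boundary terms carry the sign `μ = +1`:
`μ(d) χ̄⁺(d p) = χ̄⁺(d p)` for squarefree `d` and a prime `p` below its prime factors. [folklore] -/
theorem moebius_mul_bdry_one_eq {d p : ℕ} (hp : p.Prime) (hd : Squarefree d)
    (hlt : ∀ q ∈ d.primeFactors, p < q) :
    (μ d : ℝ) * bdry 1 β D (d * p) = bdry 1 β D (d * p) := by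
  have hd0 : d ≠ 0 := hd.ne_zero
  by_cases hpar : (d.primeFactors.card + 1) % 2 = 1 % 2
  · have heven : Even d.primeFactors.card := by rw [Nat.even_iff]; omega
    rw [moebius_of_squarefree hd, heven.neg_one_pow, one_mul]
  · rw [bdry_mul_eq_zero_of_parity hp hd0 hlt hpar, mul_zero]

/-- **The boundary expansion** (the source's "`𝟙_{(n,P(z))=1} = ∑_{d ∣ (n,P(z))} λ_d − ∑_r S_r(n)`"
for `n ≠ 1`, i.e. `∑_{d ∣ T} λ_d = ∑_r S_r`): for squarefree `T ≠ 1` with least prime factor `q(T)`,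
`∑_{d ∣ T} μ(d) χ⁺(d) = ∑_{d ∣ T/q(T)} χ̄⁺(d q(T))`, a sum of terms in `{0, 1}`.
[cite: MatomakiMerikoski2023, §3.2 (proof of Lemma 3.2 (i), first display)] -/
theorem sum_moebius_ind_one_eq_sum_bdry {T : ℕ} (hT : Squarefree T) (h1 : T ≠ 1) :
    ∑ d ∈ T.divisors, (μ d : ℝ) * ind 1 β D d =
      ∑ d ∈ (T / T.minFac).divisors, bdry 1 β D (d * T.minFac) := by
  rw [sum_moebius_ind_eq hT h1]
  refine Finset.sum_congr rfl fun d hd => ?_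
  obtain ⟨-, hlt, -, hsq⟩ := of_mem_divisors_div hT h1 hd
  exact moebius_mul_bdry_one_eq (Nat.minFac_prime h1) hsq hlt

/-- **The two properties of a boundary term** ("`p_r ≥ z_r`" and "`r ≥ uθ − β`" of the source):
if `β > 1`, `1 < z`, `1 < D`, `β log z ≤ log D`, `T ≠ 1` is squarefree with prime factors `< z`,
`d ∣ T/q(T)` and `χ̄⁺(d q(T)) ≠ 0`, then with `r = ω(d) + 1`:
`(1 − 1/β)^r log z ≤ log q(T)` and `log D < (r + β) log z`.
[cite: MatomakiMerikoski2023, §3.2 (proof of Lemma 3.2 (i))] -/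
theorem bdry_conditions (hβ : 1 < β) {z : ℝ} (hz : 1 < z) (hD1 : 1 < D)
    (hzD : β * Real.log z ≤ Real.log D) {T : ℕ} (hT : Squarefree T) (h1 : T ≠ 1)
    (hpz : ∀ p ∈ T.primeFactors, (p : ℝ) < z) {d : ℕ} (hd : d ∈ (T / T.minFac).divisors)
    (hb : bdry 1 β D (d * T.minFac) ≠ 0) :
    (1 - 1 / β) ^ (d.primeFactors.card + 1) * Real.log z ≤ Real.log T.minFac ∧
      Real.log D < ((d.primeFactors.card + 1 : ℕ) + β) * Real.log z := by
  classical
  obtain ⟨hd0, hlt, hpd, hsq⟩ := of_mem_divisors_div hT h1 hd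
  have hp := Nat.minFac_prime h1
  set t : ℕ := d * T.minFac with ht
  -- `t ∣ T`, so `t` is squarefree with prime factors `< z`
  have htT : t ∣ T := by
    have h := Nat.mul_dvd_mul (Nat.dvd_of_mem_divisors hd) (dvd_refl T.minFac)
    rwa [div_minFac_mul] at h
  have htsq : Squarefree t := hT.squarefree_of_dvd htT
  have hpzt : ∀ p ∈ t.primeFactors, (p : ℝ) < z := fun p hp' =>
    hpz p (Nat.primeFactors_mono htT hT.ne_zero hp')
  have hmin : t.minFac = T.minFac := minFac_mul_eq hp hd0 hlt
  have hdiv : t / t.minFac = d := by rw [hmin, ht, Nat.mul_div_cancel _ hp.pos]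
  have hcard : t.primeFactors.card = d.primeFactors.card + 1 :=
    card_primeFactors_mul_prime hp hd0 hpd
  -- unpack `χ̄(t) ≠ 0`
  have hb' : pred 1 β D (t / t.minFac) ∧ ¬ pred 1 β D t := by
    by_contra hcon
    apply hb
    show bdry 1 β D t = 0
    unfold bdry
    rw [if_neg hcon]
  have h := bdry_props hβ hz hD1 hzD htsq hpzt hb'.1 hb'.2
  rw [hcard, hmin] at h
  exact h

/-- **The count of boundary terms**: under the hypotheses of `bdry_conditions`, for squarefree
`T` with prime factors `< z`,
`∑_{d ∣ T} μ(d) χ⁺(d) ≤ 𝟙_{T = 1} + ∑_{1 ≤ r ≤ ω(T)} [log D < (r+β) log z ∧ (1−1/β)^r log z ≤ log q(T)] · τ(T)`.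
[cite: MatomakiMerikoski2023, §3.2 (proof of Lemma 3.2 (i))] -/
theorem sum_moebius_ind_one_le (hβ : 1 < β) {z : ℝ} (hz : 1 < z) (hD1 : 1 < D)
    (hzD : β * Real.log z ≤ Real.log D) {T : ℕ} (hT : Squarefree T)
    (hpz : ∀ p ∈ T.primeFactors, (p : ℝ) < z) :
    ∑ d ∈ T.divisors, (μ d : ℝ) * ind 1 β D d ≤
      (if T = 1 then (1 : ℝ) else 0) +
        ∑ r ∈ Icc 1 T.primeFactors.card,
          (if Real.log D < ((r : ℕ) + β) * Real.log z ∧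
              (1 - 1 / β) ^ r * Real.log z ≤ Real.log T.minFac then (T.divisors.card : ℝ) else 0) := by
  classical
  by_cases h1 : T = 1
  · subst h1
    simp [ind_one]
  rw [if_neg h1, zero_add, sum_moebius_ind_one_eq_sum_bdry hT h1]
  have hp := Nat.minFac_prime h1
  have hT0 : T ≠ 0 := hT.ne_zero
  -- each boundary term is dominated by the indicator of its own `r = ω(d) + 1`
  have hterm : ∀ d ∈ (T / T.minFac).divisors, bdry 1 β D (d * T.minFac) ≤
      ∑ r ∈ Icc 1 T.primeFactors.card,
        (if Real.log D < ((r : ℕ) + β) * Real.log z ∧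
            (1 - 1 / β) ^ r * Real.log z ≤ Real.log T.minFac then
          (if d.primeFactors.card + 1 = r then (1 : ℝ) else 0) else 0) := by
    intro d hd
    obtain ⟨hd0, hlt, hpd, hsq⟩ := of_mem_divisors_div hT h1 hd
    -- `r = ω(d) + 1 ≤ ω(T)`
    have hdT : d * T.minFac ∣ T := by
      have h := Nat.mul_dvd_mul (Nat.dvd_of_mem_divisors hd) (dvd_refl T.minFac)
      rwa [div_minFac_mul] at h
    have hrle : d.primeFactors.card + 1 ≤ T.primeFactors.card := by
      rw [← card_primeFactors_mul_prime hp hd0 hpd]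
      exact Finset.card_le_card (Nat.primeFactors_mono hdT hT0)
    have hrmem : d.primeFactors.card + 1 ∈ Icc 1 T.primeFactors.card :=
      mem_Icc.mpr ⟨by omega, hrle⟩
    by_cases hb : bdry 1 β D (d * T.minFac) = 0
    · rw [hb]
      exact Finset.sum_nonneg fun r _ => by split_ifs <;> norm_num
    · have hc' := bdry_conditions hβ hz hD1 hzD hT h1 hpz hd hb
      have hc : Real.log D < (((d.primeFactors.card + 1 : ℕ) : ℕ) + β) * Real.log z ∧
          (1 - 1 / β) ^ (d.primeFactors.card + 1) * Real.log z ≤ Real.log T.minFac :=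
        ⟨hc'.2, hc'.1⟩
      rw [← Finset.add_sum_erase _ _ hrmem, if_pos hc, if_pos rfl]
      have hrest : 0 ≤ ∑ r ∈ (Icc 1 T.primeFactors.card).erase (d.primeFactors.card + 1),
          (if Real.log D < ((r : ℕ) + β) * Real.log z ∧
              (1 - 1 / β) ^ r * Real.log z ≤ Real.log T.minFac then
            (if d.primeFactors.card + 1 = r then (1 : ℝ) else 0) else 0) :=
        Finset.sum_nonneg fun r _ => by split_ifs <;> norm_num
      linarith [bdry_le_one (par := 1) (β := β) (D := D) (d * T.minFac)]
  refine (Finset.sum_le_sum hterm).trans ?_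
  rw [Finset.sum_comm]
  refine Finset.sum_le_sum fun r _ => ?_
  by_cases hc : Real.log D < ((r : ℕ) + β) * Real.log z ∧
      (1 - 1 / β) ^ r * Real.log z ≤ Real.log T.minFac
  · rw [if_pos hc]
    calc ∑ d ∈ (T / T.minFac).divisors, (if Real.log D < ((r : ℕ) + β) * Real.log z ∧
            (1 - 1 / β) ^ r * Real.log z ≤ Real.log T.minFac then
          (if d.primeFactors.card + 1 = r then (1 : ℝ) else 0) else 0)
        ≤ ∑ _d ∈ (T / T.minFac).divisors, (1 : ℝ) :=
          Finset.sum_le_sum fun d _ => by split_ifs <;> norm_num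
      _ = ((T / T.minFac).divisors.card : ℝ) := by simp
      _ ≤ (T.divisors.card : ℝ) := by
          exact_mod_cast Finset.card_le_card
            (Nat.divisors_subset_of_dvd hT0 (Nat.div_dvd_of_dvd (Nat.minFac_dvd T)))
  · rw [if_neg hc]
    exact Finset.sum_nonpos fun d _ => by rw [if_neg hc]

/-! ### Lemma 3.2 (i): `T = (n, P_v(z))` -/

/-- `P_v(z) = ∏_{p < z, p ∤ v} p` is squarefree. [folklore] -/
theorem squarefree_prod_primesBelow_filter (z : ℝ) (v : ℕ) :
    Squarefree (∏ p ∈ (Nat.primesBelow ⌈z⌉₊).filter (fun p : ℕ => ¬ p ∣ v), p) := by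
  refine Finset.squarefree_prod_of_pairwise_isCoprime (fun p hp q hq hpq => ?_)
    fun p hp => (Nat.prime_of_mem_primesBelow (Finset.mem_filter.mp hp).1).squarefree
  simp only [← Nat.coprime_iff_isRelPrime]
  exact (Nat.coprime_primes (Nat.prime_of_mem_primesBelow (Finset.mem_filter.mp hp).1)
    (Nat.prime_of_mem_primesBelow (Finset.mem_filter.mp hq).1)).mpr hpq

/-- Membership of a prime in the prime factors of `P_v(z)`. [folklore] -/
theorem mem_primeFactors_prod_primesBelow_filter {z : ℝ} {v p : ℕ} :
    p ∈ (∏ p ∈ (Nat.primesBelow ⌈z⌉₊).filter (fun p : ℕ => ¬ p ∣ v), p).primeFactors ↔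
      p.Prime ∧ (p : ℝ) < z ∧ ¬ p ∣ v := by
  rw [Nat.primeFactors_prod (fun q hq => Nat.prime_of_mem_primesBelow (Finset.mem_filter.mp hq).1),
    Finset.mem_filter, Nat.mem_primesBelow, Nat.lt_ceil]
  tauto

/-- **Lemma 3.2 (i), lower half** (`∑_{d ∣ (n,P_v(z))} λ_d ≥ 𝟙_{(n, P_v(z)) = 1}`; the upper sieve
inequality of the tree, `BetaSieve.upper_sieve`). [cite: MatomakiMerikoski2023, Lemma 3.2 (i)] -/
theorem indicator_le_sum_weights (z : ℝ) (n v : ℕ) :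
    (if Nat.gcd n (∏ p ∈ (Nat.primesBelow ⌈z⌉₊).filter (fun p : ℕ => ¬ p ∣ v), p) = 1
        then (1 : ℝ) else 0) ≤
      ∑ d ∈ (Nat.gcd n (∏ p ∈ (Nat.primesBelow ⌈z⌉₊).filter (fun p : ℕ => ¬ p ∣ v), p)).divisors,
        (μ d : ℝ) * ind 1 β D d :=
  upper_sieve ((squarefree_prod_primesBelow_filter z v).squarefree_of_dvd (Nat.gcd_dvd_right _ _))

/-- **Matomäki–Merikoski 2023, Lemma 3.2 (i)** (upper `β`-sieve, pointwise, explicit one-sided form).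
Let `β > 1`, `1 < z`, `1 < D` with `β log z ≤ log D`, and let `λ_d = μ(d) χ⁺(d)` be the upper
`β`-sieve weights of level `D` (`χ⁺ = BetaSieve.ind 1 β D`: `d = p₁ ⋯ p_r`, `p₁ > ⋯ > p_r`, is kept
iff `p₁ ⋯ p_m p_m^β < D` for all odd `m`; "define the upper bound `β`-sieve weights
`λ_d = μ(d) 𝟙_{d ∈ 𝒟}`"). Then for every `n ≥ 1`, `v` and `A`, writing `P_v(z) = ∏_{p < z, p ∤ v} p`
and `θ = 1 − 1/β` (so that `z_r = z^{θ^r}`):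
`∑_{d ∣ (n, P_v(z))} λ_d ≤ 𝟙_{(n, P_v(z)) = 1}
  + ∑_{1 ≤ r ≤ ω(n), log D < (r + β) log z} 2^{−Ar} τ(n)^{A+1} 𝟙_{(n, P_v(z^{θ^r})) = 1}`
("`𝟙_{(n, P_v(z)) = 1} = ∑_{d ∣ (n, P_v(z))} λ_d + O(∑_{r ≥ uθ−β} 2^{−Ar} 𝟙_{(n, P_v(z_r)) = 1} τ(n)^{A+1})`"
for `D = X^θ`, `z = X^{1/u}`: then `log D < (r + β) log z ⟺ r > uθ − β`; together with
`indicator_le_sum_weights` this is the printed statement with implied constant `1`).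
[cite: MatomakiMerikoski2023, Lemma 3.2 (i)] -/
theorem sum_weights_le (hβ : 1 < β) {z : ℝ} (hz : 1 < z) (hD1 : 1 < D)
    (hzD : β * Real.log z ≤ Real.log D) {n : ℕ} (hn : n ≠ 0) (v A : ℕ) :
    ∑ d ∈ (Nat.gcd n (∏ p ∈ (Nat.primesBelow ⌈z⌉₊).filter (fun p : ℕ => ¬ p ∣ v), p)).divisors,
        (μ d : ℝ) * ind 1 β D d ≤
      (if Nat.gcd n (∏ p ∈ (Nat.primesBelow ⌈z⌉₊).filter (fun p : ℕ => ¬ p ∣ v), p) = 1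
        then (1 : ℝ) else 0) +
      ∑ r ∈ Icc 1 n.primeFactors.card,
        (if Real.log D < ((r : ℕ) + β) * Real.log z then
          (n.divisors.card : ℝ) ^ (A + 1) / 2 ^ (A * r) *
            (if Nat.gcd n (∏ p ∈ (Nat.primesBelow ⌈z ^ ((1 - 1 / β) ^ r)⌉₊).filter
                (fun p : ℕ => ¬ p ∣ v), p) = 1 then (1 : ℝ) else 0)
          else 0) := by
  classical
  set P : ℕ := ∏ p ∈ (Nat.primesBelow ⌈z⌉₊).filter (fun p : ℕ => ¬ p ∣ v), p with hP
  set T : ℕ := Nat.gcd n P with hTdef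
  have hPsq : Squarefree P := squarefree_prod_primesBelow_filter z v
  have hT : Squarefree T := hPsq.squarefree_of_dvd (Nat.gcd_dvd_right _ _)
  have hT0 : T ≠ 0 := hT.ne_zero
  have hTn : T ∣ n := Nat.gcd_dvd_left _ _
  have hTP : T ∣ P := Nat.gcd_dvd_right _ _
  -- prime factors of `T`: primes `< z`, dividing `n`, not dividing `v`
  have hpfT : ∀ p ∈ T.primeFactors, p.Prime ∧ (p : ℝ) < z ∧ ¬ p ∣ v ∧ p ∣ n := by
    intro p hp
    have h1 := Nat.primeFactors_mono hTP hPsq.ne_zero hp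
    rw [mem_primeFactors_prod_primesBelow_filter] at h1
    exact ⟨h1.1, h1.2.1, h1.2.2, (Nat.dvd_of_mem_primeFactors hp).trans hTn⟩
  have hpz : ∀ p ∈ T.primeFactors, (p : ℝ) < z := fun p hp => (hpfT p hp).2.1
  refine (sum_moebius_ind_one_le hβ hz hD1 hzD hT hpz).trans ?_
  refine add_le_add le_rfl ?_
  -- compare the `r`-sums: `Icc 1 ω(T) ⊆ Icc 1 ω(n)` and termwise
  have hωle : T.primeFactors.card ≤ n.primeFactors.card :=
    Finset.card_le_card (Nat.primeFactors_mono hTn hn)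
  have hsub : Icc 1 T.primeFactors.card ⊆ Icc 1 n.primeFactors.card :=
    Icc_subset_Icc le_rfl hωle
  have hnonneg : ∀ r ∈ Icc 1 n.primeFactors.card,
      0 ≤ (if Real.log D < ((r : ℕ) + β) * Real.log z then
          (n.divisors.card : ℝ) ^ (A + 1) / 2 ^ (A * r) *
            (if Nat.gcd n (∏ p ∈ (Nat.primesBelow ⌈z ^ ((1 - 1 / β) ^ r)⌉₊).filter
                (fun p : ℕ => ¬ p ∣ v), p) = 1 then (1 : ℝ) else 0)
          else 0) := by
    intro r _
    split_ifs <;> positivity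
  refine le_trans (Finset.sum_le_sum fun r hr => ?_) (Finset.sum_le_sum_of_subset_of_nonneg hsub
    fun r hr _ => hnonneg r hr)
  -- termwise, for `1 ≤ r ≤ ω(T)`
  obtain ⟨hr1, hrT⟩ := mem_Icc.mp hr
  by_cases hc : Real.log D < ((r : ℕ) + β) * Real.log z ∧
      (1 - 1 / β) ^ r * Real.log z ≤ Real.log T.minFac
  · rw [if_pos hc, if_pos hc.1]
    -- (a) the coprimality `(n, P_v(z^{θ^r})) = 1` from `q(T) ≥ z^{θ^r}`
    have hθ0 : 0 < 1 - 1 / β := by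
      rw [sub_pos, div_lt_one (by linarith)]; exact hβ
    have hz0 : 0 < z := by linarith
    have hT1 : T ≠ 1 := by
      intro h; rw [h] at hrT; simp at hrT; omega
    have hq := Nat.minFac_prime hT1
    have hcop : Nat.gcd n (∏ p ∈ (Nat.primesBelow ⌈z ^ ((1 - 1 / β) ^ r)⌉₊).filter
        (fun p : ℕ => ¬ p ∣ v), p) = 1 := by
      rw [← Nat.coprime_iff_gcd_eq_one]
      refine Nat.Coprime.prod_right fun p hp => ?_
      obtain ⟨hp1, hpv⟩ := Finset.mem_filter.mp hp
      obtain ⟨hpz', hpp⟩ := Nat.mem_primesBelow.mp hp1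
      have hpz'' : (p : ℝ) < z ^ ((1 - 1 / β) ^ r) := Nat.lt_ceil.mp hpz'
      rw [Nat.coprime_comm, hpp.coprime_iff_not_dvd]
      intro hpn
      -- then `p ∣ T` (as `p < z^{θ^r} ≤ z`, `p ∤ v`), so `q(T) ≤ p < z^{θ^r} ≤ q(T)`
      have hzr : z ^ ((1 - 1 / β) ^ r) ≤ z := by
        conv_rhs => rw [← Real.rpow_one z]
        exact Real.rpow_le_rpow_of_exponent_le hz.le (pow_le_one₀ hθ0.le (by
          rw [sub_le_self_iff]; positivity))
      have hpP : p ∣ P := by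
        rw [hP]
        refine Finset.dvd_prod_of_mem _ (Finset.mem_filter.mpr ⟨Nat.mem_primesBelow.mpr ⟨?_, hpp⟩, hpv⟩)
        exact Nat.lt_ceil.mpr (hpz''.trans_le hzr)
      have hpT : p ∣ T := Nat.dvd_gcd hpn hpP
      have hqp : T.minFac ≤ p := Nat.minFac_le_of_dvd hpp.two_le hpT
      have h1 : Real.log T.minFac ≤ Real.log p :=
        Real.log_le_log (by exact_mod_cast hq.pos) (by exact_mod_cast hqp)
      have h2 : Real.log p < (1 - 1 / β) ^ r * Real.log z := by
        have := Real.log_lt_log (by exact_mod_cast hpp.pos) hpz''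
        rwa [Real.log_rpow hz0] at this
      linarith [hc.2]
    rw [if_pos hcop, mul_one]
    -- (b) `τ(T) ≤ τ(n)^{A+1}/2^{Ar}`: `2^r ≤ 2^{ω(T)} = τ(T) ≤ τ(n)`
    have hτT : (T.divisors.card : ℝ) = 2 ^ T.primeFactors.card := by
      rw [Nat.card_divisors hT0]
      have : ∀ p ∈ T.primeFactors, T.factorization p = 1 := fun p hp => by
        have := hT.natFactorization_le_one p
        have hpos : 0 < T.factorization p := Nat.Prime.factorization_pos_of_dvd
          (Nat.prime_of_mem_primeFactors hp) hT0 (Nat.dvd_of_mem_primeFactors hp)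
        omega
      rw [Finset.prod_congr rfl fun p hp => by rw [this p hp]]
      simp
    have hτTn : (T.divisors.card : ℝ) ≤ n.divisors.card := by
      exact_mod_cast Finset.card_le_card (Nat.divisors_subset_of_dvd hn hTn)
    have hτn1 : (1 : ℝ) ≤ n.divisors.card := by
      exact_mod_cast Finset.one_le_card.mpr ⟨1, Nat.one_mem_divisors.mpr hn⟩
    have h2r : (2 : ℝ) ^ r ≤ T.divisors.card := by
      rw [hτT]
      exact pow_le_pow_right₀ (by norm_num) hrT
    have h2n : (2 : ℝ) ^ (A * r) ≤ (n.divisors.card : ℝ) ^ A := by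
      rw [pow_mul', ]
      exact pow_le_pow_left₀ (by positivity) (h2r.trans hτTn) A
    rw [le_div_iff₀ (by positivity)]
    calc (T.divisors.card : ℝ) * 2 ^ (A * r) ≤ n.divisors.card * (n.divisors.card : ℝ) ^ A :=
          mul_le_mul hτTn h2n (by positivity) (by positivity)
      _ = (n.divisors.card : ℝ) ^ (A + 1) := by ring
  · rw [if_neg hc]
    split_ifs <;> positivity

end BetaSieve

end Literature.NumberTheory.Sieve
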